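import Literature.AlgebraicGeometry.Resolution.LogRegularResolutionHolds
import Literature.AlgebraicGeometry.Resolution.LogBlowupOrthantRelative
import Literature.AlgebraicGeometry.Resolution.LogRegularResolutionGeneral
import Literature.AlgebraicGeometry.Resolution.AffineBlowupResolutionCriterion
import HarnessLib

/-!
# Crux `FrobeniusLadder.FRationalResolution` (stmt-ResolutionOfSingularities-15317), line `redirect`,
# stub `stub_diagonalizableQuotientResolution` — the scheme side of brick T1: a regular projective subdivision whose
# support function VANISHES ON THE BOUNDARY yields a monomial blow-up centre with regular blow-up and cosupport inside
# the closed stratum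

Brick T1 of the repair census ("strong toric resolution by ONE `𝔪`-primary monomial blow-up at an isolated toric
singularity") split along the tree's Kato pipeline. This file is the SCHEME/MONOID half, for an arbitrary Noetherian
ring `A` with an fs chart `φ : P → A` (`P ⊆ ℤⁿ` finitely generated, saturated, spanning) log regular at every prime:
given a regular fan `Δ` with support `P^∨` and tight integral strict support data `m ≥ 0` on it (the input of
`LogBlowup.exists_finset_isOrthantLike_of_isStrictSupport`) whose value function VANISHES WHEREVER A NON-ZERO ELEMENT
OF `P` VANISHES (i.e. on the boundary of `P^∨`) and is not identically zero, the finite set `s ⊆ P` of degree-`k`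
generators of the section monoid (`k` a Veronese degree) satisfies

* `Bl_{(φ(s))} Spec A` is REGULAR (Kato (10.3) on the orthant-like charts,
  `LogRefinedChart.isRegularLocalRing_localization_chartAlgebra`, assembled by
  `affineBlowup.isRegular_of_isRegularLocalRing_localization`);
* `0 ∉ s`, so `(φ(s)) ⊆ (φ(P ∖ 0))`;
* every prime `𝔓 ⊇ (φ(s))` contains `φ(P ∖ 0)` — the cosupport of the centre is the closed stratum `V(φ(P ∖ 0))`
  (saturation step `LogBlowup.exists_add_mem_piece` with `q = 0` along the multiples of `p`: some `N p ∈ Γ_k = s + P`,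
  so `φ(p)^N ∈ φ(a) · A ⊆ 𝔓`).

At a `D(A)`-fixed point `𝔮` of a quotient chart the Kato ideal `(φ(P ∖ 0))` localizes to `𝔮` (`…FixedPointKatoIdeal`),
so the centre is `𝔮`-primary near `𝔮` when `𝔮` is closed: the input of `…PrimaryCentreEtale` /
`…EtaleChartPrimaryCentre`. What is NOT here (the FAN half of T1): the existence of such `Δ, m` when the proper faces
of `P^∨` are regular (regularisation by star subdivisions through interior points only, support function of the
composite vanishing on the untouched boundary).
* `exists_monomialCentre_regular_affineBlowup_faces` — the same WITHOUT the global vanishing hypothesis: a prime over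
  the centre contains `φ(p)` for every non-zero `p` on whose orthogonal face the value function vanishes (so its unit face is
  a face the subdivision refines) — the form used when only the REGULAR proper faces survive the subdivision.

Honest label: plumbing + assembly over the tree's Kato (10.4) pipeline (no stub closed by name). No definitions, no
named facts, no sorry. [cite: Kato1994, (9.8), (10.3), (10.4)] [cite: KempfEtAl1973, Ch. I §2 Thm. 11]
[cite: GortzWedhorn2020, (13.19)]
-/

noncomputable section

-- single-problem summit: the doubled namespace component is forced
set_option linter.dupNamespace false

open AlgebraicGeometry
open Literature.AlgebraicGeometry.Resolution Literature.Geometry.PolyhedralFans PointedCone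
open Literature.Combinatorics.Optimization.HilbertBasis (toRat toRat_add toRat_zero toRat_nsmul)
open Literature.AlgebraicGeometry.Resolution.LogBlowup

namespace Summit.ResolutionOfSingularities.ResolutionOfSingularities.Theorems.FRationalResolution.PrimaryMonomialCentre

variable {n : ℕ}

/-- **T1, scheme/monoid half: the monomial centre of a regular projective subdivision whose support function vanishes
on the boundary.** Let `A` be Noetherian with an fs chart `φ : P → A` (`P ⊆ ℤⁿ` finitely generated, saturated,
spanning) log regular at every prime; `Δ` a regular fan with support `P^∨`; `m` tight integral strict support data on
`Δ`, non-negative on `P^∨`, whose value function vanishes at every `v ∈ P^∨` annihilated by some non-zero `p ∈ P` and is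
positive somewhere. Then for some non-empty finite `s ⊆ P ∖ 0` the blowing up of `Spec A` along `(φ(s))` is regular and
every prime ideal containing `(φ(s))` contains `φ(P ∖ 0)`. [cite: Kato1994, (10.3), (10.4)]
[cite: KempfEtAl1973, Ch. I §2 Thm. 11] [cite: GortzWedhorn2020, (13.19)] -/
theorem exists_monomialCentre_regular_affineBlowup {A : Type} [CommRing A] [IsNoetherianRing A]
    {P : AddSubmonoid (Fin n → ℤ)} (hP : P.FG)
    (hsat : ∀ (v : Fin n → ℤ) (k : ℕ), 0 < k → k • v ∈ P → v ∈ P)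
    (hspan : Submodule.span ℤ (P : Set (Fin n → ℤ)) = ⊤)
    {φ : Multiplicative P →* A} (hreg : ∀ (𝔭 : Ideal A) [𝔭.IsPrime], LogChart.IsLogRegularAt P φ 𝔭)
    (Δ : Fan ℚ (Fin n → ℚ)) (hsupp : Δ.support = (dualCone P : Set (Fin n → ℚ)))
    (hΔ : Δ.IsRegular) (m : PointedCone ℚ (Fin n → ℚ) → (Fin n → ℚ))
    (hm : Δ.IsStrictSupport m) (hint : ∀ ρ ∈ Δ.cones, m ρ ∈ latticeN (Fin n))
    (hnn : ∀ ρ ∈ Δ.cones, ∀ x ∈ dualCone P, 0 ≤ m ρ ⬝ᵥ x)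
    (hf0 : ∀ ρ ∈ Δ.cones, ∀ v ∈ ρ, ∀ p ∈ P, p ≠ 0 → toRat p ⬝ᵥ v = 0 → m ρ ⬝ᵥ v = 0)
    (hpos : ∃ ρ ∈ Δ.cones, ∃ v ∈ ρ, 0 < m ρ ⬝ᵥ v) :
    ∃ s : Finset P, s.Nonempty ∧ (∀ a ∈ s, (a : Fin n → ℤ) ≠ 0) ∧
      Scheme.IsRegular (affineBlowup
        (Ideal.span ((fun p : P => φ (Multiplicative.ofAdd p)) '' (s : Set P)))) ∧
      ∀ (𝔓 : Ideal A) [𝔓.IsPrime],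
        Ideal.span ((fun p : P => φ (Multiplicative.ofAdd p)) '' (s : Set P)) ≤ 𝔓 →
          ∀ p : P, (p : Fin n → ℤ) ≠ 0 → φ (Multiplicative.ofAdd p) ∈ 𝔓 := by
  classical
  obtain ⟨k, hk, hver⟩ := exists_veronese Δ m
  obtain ⟨s, hsne, hsk, hsgen, hcharts⟩ :=
    exists_finset_isOrthantLike_of_isStrictSupport P hP hsat Δ hsupp hΔ m hm hint hnn hk hver
  refine ⟨s, hsne, ?_, ?_, ?_⟩
  · -- `0 ∉ Γ_k` because the value function is positive somewhere
    intro a ha h0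
    obtain ⟨ρ, hρ, v, hv, hlt⟩ := hpos
    have h1 := (mem_secMonoid_iff Δ m).1 ((mem_piece_iff Δ m).1 (hsk a ha)) ρ hρ v hv
    simp only [h0, toRat_zero, zero_sub, neg_dotProduct, smul_dotProduct, smul_eq_mul] at h1
    have : (0 : ℚ) < (k : ℚ) * (m ρ ⬝ᵥ v) := mul_pos (by exact_mod_cast hk) hlt
    linarith
  · -- the blow-up along `(φ(s))` is regular: Kato (10.3) on the orthant-like charts
    refine affineBlowup.isRegular_of_isRegularLocalRing_localization
      (I := Ideal.span ((fun p : P => φ (Multiplicative.ofAdd p)) '' (s : Set P)))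
      (fun a : s => φ (Multiplicative.ofAdd (a : P))) (fun a => Ideal.subset_span ⟨a, a.2, rfl⟩)
      (Ideal.span_le.2 ?_) ?_
    · rintro _ ⟨p, hp, rfl⟩
      exact Ideal.subset_span ⟨⟨p, hp⟩, rfl⟩
    · intro a 𝔓 _
      obtain ⟨b, I, hQ⟩ := hcharts a a.2
      exact LogRefinedChart.isRegularLocalRing_localization_chartAlgebra hP hsat hspan
        (fun 𝔭 _ => hreg 𝔭) hQ (LogChart.le_blowupChartMonoid P (↑s) a) (LogChart.blowupChart P φ (↑s) a)
        (fun p => LogChart.blowupChart_of_mem P φ (↑s) a p)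
        (LogChart.adjoin_range_blowupChart_eq_top P φ (↑s) a)
        (fun L _ g hg => blowupAlgebra_exists_extend _ _ L g (hg a)) 𝔓
  · -- cosupport: every prime over `(φ(s))` contains `φ(P ∖ 0)`
    intro 𝔓 _ hI p hp0
    by_contra hnot
    -- the value function of the tight data
    have hf : ∃ f : (Fin n → ℚ) → ℚ, ∀ ρ ∈ Δ.cones, ∀ x ∈ ρ, m ρ ⬝ᵥ x = f x := by
      refine ⟨fun x => if h : ∃ ρ ∈ Δ.cones, x ∈ ρ then m h.choose ⬝ᵥ x else 0, ?_⟩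
      intro ρ hρ x hx
      have h : ∃ ρ ∈ Δ.cones, x ∈ ρ := ⟨ρ, hρ, hx⟩
      beta_reduce
      rw [dif_pos h]
      exact hm.eq_of_mem_of_mem hρ h.choose_spec.1 hx h.choose_spec.2
    obtain ⟨f, hmf⟩ := hf
    -- the multiples of `p`
    set F : AddSubmonoid (Fin n → ℤ) := AddSubmonoid.closure {(p : Fin n → ℤ)} with hFdef
    have hFP : F ≤ P := by
      rw [hFdef, AddSubmonoid.closure_le, Set.singleton_subset_iff]
      exact p.2
    have hq : ∀ v ∈ dualCone P, (∀ g ∈ F, toRat g ⬝ᵥ v = 0) →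
        (k : ℚ) * f v ≤ toRat (0 : Fin n → ℤ) ⬝ᵥ v := by
      intro v hv hFv
      have hpv : toRat (p : Fin n → ℤ) ⬝ᵥ v = 0 := hFv _ (AddSubmonoid.subset_closure rfl)
      have hv' : v ∈ Δ.support := by rw [hsupp]; exact hv
      obtain ⟨ρ, hρ, hvρ⟩ := Fan.mem_support.1 hv'
      rw [← hmf ρ hρ v hvρ, hf0 ρ hρ v hvρ (p : Fin n → ℤ) p.2 hp0 hpv, toRat_zero, zero_dotProduct,
        mul_zero]
    obtain ⟨g, hgF, hg⟩ := exists_add_mem_piece P F hFP Δ hsupp m f hmf k 0 hq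
    rw [zero_add] at hg
    obtain ⟨N, hN⟩ : ∃ N : ℕ, N • (p : Fin n → ℤ) = g := AddSubmonoid.mem_closure_singleton.1 hgF
    -- `g = a + z` with `a ∈ s`, `z ∈ P`
    obtain ⟨a, ha, hz⟩ := hsgen g hg
    have hgP : g ∈ P := hFP hgF
    have hmem : φ (Multiplicative.ofAdd (⟨g, hgP⟩ : P)) ∈ 𝔓 := by
      have heq : (⟨g, hgP⟩ : P) = a + ⟨g - a, hz⟩ := by
        apply Subtype.ext
        simp
      rw [heq, ofAdd_add, map_mul]
      exact 𝔓.mul_mem_right _ (hI (Ideal.subset_span ⟨a, ha, rfl⟩))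
    have hpow : φ (Multiplicative.ofAdd (⟨g, hgP⟩ : P)) = φ (Multiplicative.ofAdd p) ^ N := by
      rw [← map_pow, ← ofAdd_nsmul]
      congr 2
      apply Subtype.ext
      simp [← hN]
    rw [hpow] at hmem
    exact hnot (‹𝔓.IsPrime›.mem_of_pow_mem N hmem)

/-- **Cosupport of the monomial centre, face by face** (the form without a global vanishing hypothesis): with the data of
`exists_monomialCentre_regular_affineBlowup` minus `hf0`, the section-monoid generators `s` of ANY regular subdivision with
integral tight strict support `m ≥ 0`, `≢ 0`, give a regular blow-up `Bl_{(φ(s))}`, `0 ∉ s`, and: **every prime `𝔓 ⊇ (φ(s))`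
contains `φ(p)` for each non-zero `p ∈ P` on whose orthogonal face `p^⊥ ∩ P^∨` the value function vanishes.** So the unit
face of such a `𝔓` is a face of `P` whose dual cone carries a non-zero value of the support function — a face the
subdivision has refined. (Same proof, the vanishing being used only at `p`.) [cite: Kato1994, (10.3), (10.4)]
[cite: KempfEtAl1973, Ch. I §2 Thm. 11] -/
theorem exists_monomialCentre_regular_affineBlowup_faces {A : Type} [CommRing A] [IsNoetherianRing A]
    {P : AddSubmonoid (Fin n → ℤ)} (hP : P.FG)
    (hsat : ∀ (v : Fin n → ℤ) (k : ℕ), 0 < k → k • v ∈ P → v ∈ P)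
    (hspan : Submodule.span ℤ (P : Set (Fin n → ℤ)) = ⊤)
    {φ : Multiplicative P →* A} (hreg : ∀ (𝔭 : Ideal A) [𝔭.IsPrime], LogChart.IsLogRegularAt P φ 𝔭)
    (Δ : Fan ℚ (Fin n → ℚ)) (hsupp : Δ.support = (dualCone P : Set (Fin n → ℚ)))
    (hΔ : Δ.IsRegular) (m : PointedCone ℚ (Fin n → ℚ) → (Fin n → ℚ))
    (hm : Δ.IsStrictSupport m) (hint : ∀ ρ ∈ Δ.cones, m ρ ∈ latticeN (Fin n))
    (hnn : ∀ ρ ∈ Δ.cones, ∀ x ∈ dualCone P, 0 ≤ m ρ ⬝ᵥ x)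
    (hpos : ∃ ρ ∈ Δ.cones, ∃ v ∈ ρ, 0 < m ρ ⬝ᵥ v) :
    ∃ s : Finset P, s.Nonempty ∧ (∀ a ∈ s, (a : Fin n → ℤ) ≠ 0) ∧
      Scheme.IsRegular (affineBlowup
        (Ideal.span ((fun p : P => φ (Multiplicative.ofAdd p)) '' (s : Set P)))) ∧
      ∀ (𝔓 : Ideal A) [𝔓.IsPrime],
        Ideal.span ((fun p : P => φ (Multiplicative.ofAdd p)) '' (s : Set P)) ≤ 𝔓 →
          ∀ p : P, (p : Fin n → ℤ) ≠ 0 →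
            (∀ ρ ∈ Δ.cones, ∀ v ∈ ρ, toRat (p : Fin n → ℤ) ⬝ᵥ v = 0 → m ρ ⬝ᵥ v = 0) →
              φ (Multiplicative.ofAdd p) ∈ 𝔓 := by
  classical
  obtain ⟨k, hk, hver⟩ := exists_veronese Δ m
  obtain ⟨s, hsne, hsk, hsgen, hcharts⟩ :=
    exists_finset_isOrthantLike_of_isStrictSupport P hP hsat Δ hsupp hΔ m hm hint hnn hk hver
  refine ⟨s, hsne, ?_, ?_, ?_⟩
  · intro a ha h0
    obtain ⟨ρ, hρ, v, hv, hlt⟩ := hpos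
    have h1 := (mem_secMonoid_iff Δ m).1 ((mem_piece_iff Δ m).1 (hsk a ha)) ρ hρ v hv
    simp only [h0, toRat_zero, zero_sub, neg_dotProduct, smul_dotProduct, smul_eq_mul] at h1
    have : (0 : ℚ) < (k : ℚ) * (m ρ ⬝ᵥ v) := mul_pos (by exact_mod_cast hk) hlt
    linarith
  · refine affineBlowup.isRegular_of_isRegularLocalRing_localization
      (I := Ideal.span ((fun p : P => φ (Multiplicative.ofAdd p)) '' (s : Set P)))
      (fun a : s => φ (Multiplicative.ofAdd (a : P))) (fun a => Ideal.subset_span ⟨a, a.2, rfl⟩)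
      (Ideal.span_le.2 ?_) ?_
    · rintro _ ⟨p, hp, rfl⟩
      exact Ideal.subset_span ⟨⟨p, hp⟩, rfl⟩
    · intro a 𝔓 _
      obtain ⟨b, I, hQ⟩ := hcharts a a.2
      exact LogRefinedChart.isRegularLocalRing_localization_chartAlgebra hP hsat hspan
        (fun 𝔭 _ => hreg 𝔭) hQ (LogChart.le_blowupChartMonoid P (↑s) a) (LogChart.blowupChart P φ (↑s) a)
        (fun p => LogChart.blowupChart_of_mem P φ (↑s) a p)
        (LogChart.adjoin_range_blowupChart_eq_top P φ (↑s) a)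
        (fun L _ g hg => blowupAlgebra_exists_extend _ _ L g (hg a)) 𝔓
  · intro 𝔓 _ hI p hp0 hf0p
    by_contra hnot
    have hf : ∃ f : (Fin n → ℚ) → ℚ, ∀ ρ ∈ Δ.cones, ∀ x ∈ ρ, m ρ ⬝ᵥ x = f x := by
      refine ⟨fun x => if h : ∃ ρ ∈ Δ.cones, x ∈ ρ then m h.choose ⬝ᵥ x else 0, ?_⟩
      intro ρ hρ x hx
      have h : ∃ ρ ∈ Δ.cones, x ∈ ρ := ⟨ρ, hρ, hx⟩
      beta_reduce
      rw [dif_pos h]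
      exact hm.eq_of_mem_of_mem hρ h.choose_spec.1 hx h.choose_spec.2
    obtain ⟨f, hmf⟩ := hf
    set F : AddSubmonoid (Fin n → ℤ) := AddSubmonoid.closure {(p : Fin n → ℤ)} with hFdef
    have hFP : F ≤ P := by
      rw [hFdef, AddSubmonoid.closure_le, Set.singleton_subset_iff]
      exact p.2
    have hq : ∀ v ∈ dualCone P, (∀ g ∈ F, toRat g ⬝ᵥ v = 0) →
        (k : ℚ) * f v ≤ toRat (0 : Fin n → ℤ) ⬝ᵥ v := by
      intro v hv hFv
      have hpv : toRat (p : Fin n → ℤ) ⬝ᵥ v = 0 := hFv _ (AddSubmonoid.subset_closure rfl)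
      have hv' : v ∈ Δ.support := by rw [hsupp]; exact hv
      obtain ⟨ρ, hρ, hvρ⟩ := Fan.mem_support.1 hv'
      rw [← hmf ρ hρ v hvρ, hf0p ρ hρ v hvρ hpv, toRat_zero, zero_dotProduct, mul_zero]
    obtain ⟨g, hgF, hg⟩ := exists_add_mem_piece P F hFP Δ hsupp m f hmf k 0 hq
    rw [zero_add] at hg
    obtain ⟨N, hN⟩ : ∃ N : ℕ, N • (p : Fin n → ℤ) = g := AddSubmonoid.mem_closure_singleton.1 hgF
    obtain ⟨a, ha, hz⟩ := hsgen g hg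
    have hgP : g ∈ P := hFP hgF
    have hmem : φ (Multiplicative.ofAdd (⟨g, hgP⟩ : P)) ∈ 𝔓 := by
      have heq : (⟨g, hgP⟩ : P) = a + ⟨g - a, hz⟩ := by
        apply Subtype.ext
        simp
      rw [heq, ofAdd_add, map_mul]
      exact 𝔓.mul_mem_right _ (hI (Ideal.subset_span ⟨a, ha, rfl⟩))
    have hpow : φ (Multiplicative.ofAdd (⟨g, hgP⟩ : P)) = φ (Multiplicative.ofAdd p) ^ N := by
      rw [← map_pow, ← ofAdd_nsmul]
      congr 2
      apply Subtype.ext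
      simp [← hN]
    rw [hpow] at hmem
    exact hnot (‹𝔓.IsPrime›.mem_of_pow_mem N hmem)

end Summit.ResolutionOfSingularities.ResolutionOfSingularities.Theorems.FRationalResolution.PrimaryMonomialCentre

end
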